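import Summits.ABC.IUTFork.Joshi.ATS4GenuineResidualLambdaSevenFibres
import HarnessLib

/-!
# [J-IV] (arXiv:2403.10430v2) §6.10–§6.11 at GENUINE components, `d = 1`: the `ℚ`-family `μ_k = 1/2 + 2/11^k` and its two fibre sums at the
# prime `11` — `ord_11 j(μ_k) = −2k`, `log q^∀(μ_k) ≤ 6k·log 11 + 12·log 2`, `q₁₁ = 2k·log 11` exactly, `d₁₁ ≤ log 11` on the whole `ℓ`-division tower

Proof-only companion (0 defs) of the abc-iut cell, sub-cell R-J «JOSHI Y-DISCHARGE CENSUS» (rung LADDER-ABC:A2.RESCUE.J; table of record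
`HOME/plan/E/R-J/Y-CENSUS.tsv`, row Y-21 PARENT), seat abc-iut-E-t35 (gen 12), E ROW R-27 (`HOME/plan/E/R-J/E-ROWS.md` §E) part (2), `d = 1`:
the `p₀ = 11` twin of this seat's gen-10 `ATS4GenuineResidualLambdaSevenFibres` (p487789; `λ_k = 1/2 + 2/7^k`, `p₀ = 7`). The census small print
(r2) covers `d = 1` on `λ_k` for every prime `ℓ ≥ 11` — with `p₀ = 7` the excluded prime is the binder-admissible `ℓ = 7` itself (tameness of `K/F`
above `p₀` needs `ℓ ≠ p₀`). The sequel `ATS4DescentSpineGenuineResidualUnsatDegOneEleven` closes that edge with the SAME mechanism at the next prime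
`p₀ = 11 ∤ 2·46080` on the `ℚ`-family `μ_k := 1/2 + 2/11^k` of the same shape — a `K_V = CBData.std {2}` family (`|μ_k − 1/2| = 2/11^k ≤ 1/4`,
`‖μ_k − 1/2‖₂ = ‖2‖₂`). THIS FILE supplies the point and its genuine `11`-components, via the generic degree-one lemmas `DegOne.*` of p487789:

* §1 the point (adapted from abc-iut-w5-d044 / abc-iut-S-d3's `Cor22.jInv_lamSeven_eq`, `ord_jInv_lamSeven`, `logQForall_ratPoint_lamSeven_le`,
  `ratPoint_lam_mem_std_two`, `7 ↦ 11`): `jInv_lamEleven_eq` (`j(μ_k) = 2⁶(3·11^{2k}+16)³/((11^k+4)²(11^k−4)²·11^{2k})`), `ord_jInv_lamEleven`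
  (`ord_11 j(μ_k) = −2k`), `lamEleven_ne`, `ratPoint_lamEleven_mem_UPle_one`, `ratPoint_lamEleven_mem_std_two`, `logQForall_ratPoint_lamEleven_le`;
* §2 the instances of `DegOne.*`: `exists_mem_V_residueChar_eq_eleven` (`11 ∈ V^dst_ℚ` forced for `ℓ ≠ 11`), `qEleven_eq` (`q₁₁ = 2k·log 11` EXACTLY over
  any `M ⊇ ℚ`, `S = {2, ℓ}`, `ℓ ≠ 11`), `dEleven_le` (`d₁₁ ≤ log 11` for every theta field `F`, every `K` Galois/`F` inside `F(E_F[ℓ])`, `ℓ ≠ 11`, any `D_K`).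

SOURCE locators: [J-IV] Prop. 6.10.9 p.69 l.1–28, (6.11.1) p.69 l.73–p.70 l.3, p.70 l.4–29 (render `HOME/lit/renders/Joshi-arxiv-2403.10430/`);
[IUTchIV] Prop. 1.3 p.12, Prop. 1.8 (vii) p.19, Def. 1.9 (i) p.22, Cor. 2.2 (ii) proof (P5) p.46 (kurims); [GenEll] Ex. 1.3 (i)–(ii) p.5.
FRAMING (binding): classical arithmetic of the `λ`-line and Dedekind theory composed with the tree's PROVED tameness of the division tower; NO side
taken on [IUTchIII] Cor. 3.12 / [IUTchIV] Thm. 1.10, on Joshi's claims or on Mochizuki's report; NOT an abc claim; typed ≠ proved ≠ endorsed.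
Theorems only; standard axioms. [claim: Joshi2024ATS4, status: disputed] (locators).
-/

noncomputable section

namespace Summit.ABC.IUTFork.Joshi.ATS4

open NumberField IsDedekindDomain Finset Metric
open Literature.IUT.LogVolume Literature.IUT.LogVolume.Cor22
open Literature.NumberTheory.DiophantineGeometry Literature.NumberTheory.DiophantineGeometry.GenEll
open Literature.NumberTheory.EllipticCurves
open scoped Classical

namespace LambdaElevenResidual

/-! ## 1. The point `μ_k = 1/2 + 2/11^k`: the `j`-invariant, its pole at `11`, its height -/

/-- A natural number prime to the prime under `v` has `ord_v = 0`. [folklore] -/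
private theorem ord_natCast_eq_zero_of_not_dvd (v : HeightOneSpectrum (𝓞 ℚ)) {n : ℕ}
    (h : ¬ Rat.HeightOneSpectrum.natGenerator v ∣ n) : ord ℚ v (n : ℚ) = 0 := by
  unfold ord
  rw [(UniformABCConjecture.valuation_natCast_eq_one_iff v n).2 h, WithZero.log_one, neg_zero]

/-- `11 ∤ 11^k + 4` (`k ≥ 1`). [folklore] -/
private theorem not_eleven_dvd_pow_add_four {k : ℕ} (hk : 1 ≤ k) : ¬ 11 ∣ 11 ^ k + 4 := fun h => by
  have : 11 ∣ 4 := (Nat.dvd_add_right (dvd_pow_self 11 (by omega : k ≠ 0))).1 h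
  omega

/-- `11 ∤ 11^k − 4` (`k ≥ 1`). [folklore] -/
private theorem not_eleven_dvd_pow_sub_four {k : ℕ} (hk : 1 ≤ k) : ¬ 11 ∣ 11 ^ k - 4 := fun h => by
  have hle : 11 ≤ 11 ^ k := by simpa using Nat.pow_le_pow_right (by norm_num : 1 ≤ 11) hk
  have : 11 ∣ 11 ^ k - (11 ^ k - 4) := Nat.dvd_sub (dvd_pow_self 11 (by omega : k ≠ 0)) h
  rw [Nat.sub_sub_self (by omega : 4 ≤ 11 ^ k)] at this
  omega

/-- `11 ∤ 3·11^(2k) + 16` (`k ≥ 1`). [folklore] -/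
private theorem not_eleven_dvd_three_mul_pow_add {k : ℕ} (hk : 1 ≤ k) : ¬ 11 ∣ 3 * 11 ^ (2 * k) + 16 := fun h => by
  have : 11 ∣ 16 := (Nat.dvd_add_right ((dvd_pow_self 11 (by omega : 2 * k ≠ 0)).mul_left 3)).1 h
  omega

/-- **`j(μ_k) = 2^6·(3·11^{2k} + 16)^3 / ((11^k + 4)^2·(11^k − 4)^2·11^{2k})`** for `μ_k = 1/2 + 2/11^k`, `k ≥ 1`: the `j`-invariant
`j = 2^8(λ²−λ+1)³/(λ²(λ−1)²)` of the Legendre curve at the point. [cite: MochizukiGenEll2010, Ex 1.3 (i) p.5] -/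
theorem jInv_lamEleven_eq {k : ℕ} (hk : 1 ≤ k) :
    jInv ((2 : ℚ)⁻¹ + 2 / 11 ^ k) =
      ((64 * (3 * 11 ^ (2 * k) + 16) ^ 3 : ℕ) : ℚ) / ((((11 ^ k + 4) ^ 2 * (11 ^ k - 4) ^ 2 : ℕ) : ℚ) * (11 : ℚ) ^ (2 * k)) := by
  -- adapted from `Cor22.jInv_lamSeven_eq` (abc-iut-w5-d044 / abc-iut-S-d3), `7 ↦ 11`
  have hle : 11 ≤ 11 ^ k := by simpa using Nat.pow_le_pow_right (by norm_num : 1 ≤ 11) hk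
  have hx : (11 : ℚ) ^ k ≠ 0 := pow_ne_zero _ (by norm_num)
  have h4 : (11 : ℚ) ^ k - 4 ≠ 0 := by
    have : ((11 ^ k : ℕ) : ℚ) - 4 ≠ 0 := by
      have h' : (11 : ℚ) ≤ ((11 ^ k : ℕ) : ℚ) := by exact_mod_cast hle
      intro h0; linarith
    simpa using this
  have h5 : (11 : ℚ) ^ k + 4 ≠ 0 := by positivity
  have hn1 : ((64 * (3 * 11 ^ (2 * k) + 16) ^ 3 : ℕ) : ℚ) = 64 * (3 * (11 : ℚ) ^ (2 * k) + 16) ^ 3 := by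
    push_cast; ring
  have hn2 : (((11 ^ k + 4) ^ 2 * (11 ^ k - 4) ^ 2 : ℕ) : ℚ) = ((11 : ℚ) ^ k + 4) ^ 2 * ((11 : ℚ) ^ k - 4) ^ 2 := by
    rw [Nat.cast_mul, Nat.cast_pow, Nat.cast_pow, Nat.cast_sub (by omega : 4 ≤ 11 ^ k)]
    push_cast; ring
  have hA : ((2 : ℚ)⁻¹ + 2 / 11 ^ k) ^ 2 - ((2 : ℚ)⁻¹ + 2 / 11 ^ k) + 1 =
      (3 * 11 ^ (2 * k) + 16) / (4 * 11 ^ (2 * k)) := by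
    field_simp; ring
  have hB : ((2 : ℚ)⁻¹ + 2 / 11 ^ k) ^ 2 * (((2 : ℚ)⁻¹ + 2 / 11 ^ k) - 1) ^ 2 =
      (11 ^ k + 4) ^ 2 * (11 ^ k - 4) ^ 2 / (16 * 11 ^ (4 * k)) := by
    field_simp; ring
  rw [hn1, hn2]
  unfold jInv
  rw [hA, hB]
  field_simp
  ring

/-- **`ord_v j(μ_k) = −2k`** at the place `v` of `ℚ` over `11` (`k ≥ 1`): `11` divides neither `3·11^{2k}+16` nor `11^k ± 4`, and
`ord_v(11) = 1`. [cite: MochizukiGenEll2010, Ex 1.3 (i) p.5] -/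
theorem ord_jInv_lamEleven (v : HeightOneSpectrum (𝓞 ℚ)) (hv : Rat.HeightOneSpectrum.natGenerator v = 11) {k : ℕ} (hk : 1 ≤ k) :
    ord ℚ v (jInv ((2 : ℚ)⁻¹ + 2 / 11 ^ k)) = -(2 * k : ℤ) := by
  -- adapted from `Cor22.ord_jInv_lamSeven` (abc-iut-w5-d044 / abc-iut-S-d3), `7 ↦ 11`
  have h11p : Nat.Prime 11 := by norm_num
  have hle : 11 ≤ 11 ^ k := by simpa using Nat.pow_le_pow_right (by norm_num : 1 ≤ 11) hk
  have hA : ¬ Rat.HeightOneSpectrum.natGenerator v ∣ 64 * (3 * 11 ^ (2 * k) + 16) ^ 3 := by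
    rw [hv]; intro h
    rcases (Nat.Prime.dvd_mul h11p).1 h with h | h
    · omega
    · exact not_eleven_dvd_three_mul_pow_add hk (Nat.Prime.dvd_of_dvd_pow h11p h)
  have hB : ¬ Rat.HeightOneSpectrum.natGenerator v ∣ (11 ^ k + 4) ^ 2 * (11 ^ k - 4) ^ 2 := by
    rw [hv]; intro h
    rcases (Nat.Prime.dvd_mul h11p).1 h with h | h
    · exact not_eleven_dvd_pow_add_four hk (Nat.Prime.dvd_of_dvd_pow h11p h)
    · exact not_eleven_dvd_pow_sub_four hk (Nat.Prime.dvd_of_dvd_pow h11p h)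
  have hA0 : ((64 * (3 * 11 ^ (2 * k) + 16) ^ 3 : ℕ) : ℚ) ≠ 0 := by positivity
  have hB0 : (((11 ^ k + 4) ^ 2 * (11 ^ k - 4) ^ 2 : ℕ) : ℚ) ≠ 0 := by
    have : (11 ^ k + 4) ^ 2 * (11 ^ k - 4) ^ 2 ≠ 0 :=
      mul_ne_zero (pow_ne_zero _ (by omega)) (pow_ne_zero _ (by omega))
    exact_mod_cast this
  have h110 : (11 : ℚ) ^ (2 * k) ≠ 0 := pow_ne_zero _ (by norm_num)
  have h11 : ord ℚ v (11 : ℚ) = 1 := by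
    have := ord_natGenerator_eq_one v
    rwa [hv, Nat.cast_ofNat] at this
  rw [jInv_lamEleven_eq hk, div_eq_mul_inv, ord_mul ℚ v hA0 (inv_ne_zero (mul_ne_zero hB0 h110)), ord_inv,
    ord_mul ℚ v hB0 h110, ord_pow, ord_natCast_eq_zero_of_not_dvd v hA, ord_natCast_eq_zero_of_not_dvd v hB, h11]
  push_cast
  ring

/-- `μ_k = 1/2 + 2/11^k ≠ 0, 1` (`k ≥ 1`): the point lies in `U_P = ℙ¹ ∖ {0, 1, ∞}`. [cite: MochizukiGenEll2010, Ex 1.3 (i) p.5] -/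
theorem lamEleven_ne {k : ℕ} (hk : 1 ≤ k) : ((2 : ℚ)⁻¹ + 2 / 11 ^ k) ≠ 0 ∧ ((2 : ℚ)⁻¹ + 2 / 11 ^ k) ≠ 1 := by
  have h1 : (0 : ℚ) < 2 / 11 ^ k := by positivity
  have h11k : (11 : ℚ) ≤ 11 ^ k := by exact_mod_cast Nat.le_self_pow (by omega : k ≠ 0) 11
  have h2 : (2 : ℚ) / 11 ^ k ≤ 2 / 11 := div_le_div_of_nonneg_left (by norm_num) (by norm_num) h11k
  constructor <;> intro h <;> linarith

/-- `ratPoint μ_k ∈ U_X(ℚ̄)^{≤1}` (minimally presented over `ℚ`, `μ_k ≠ 0, 1`). [cite: MochizukiGenEll2010, Ex 1.3 (i) p.5] -/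
theorem ratPoint_lamEleven_mem_UPle_one {k : ℕ} (hk : 1 ≤ k) : ratPoint ((2 : ℚ)⁻¹ + 2 / 11 ^ k) ∈ UPle 1 :=
  ratPoint_mem_UPle_one (lamEleven_ne hk).1 (lamEleven_ne hk).2

/-- `ratPoint μ_k ∈ K_V = CBData.std {2}` (`k ≥ 1`): `|μ_k − 1/2| = 2/11^k ≤ 1/4` and `‖μ_k − 1/2‖₂ = ‖2‖₂·‖11‖₂^{−k} = ‖2‖₂` — the family lives
in the same compactly bounded set as `λ_k` (adapted from abc-iut-S-d3's `Cor22.ratPoint_lam_mem_std_two`). [cite: MochizukiGenEll2010, Ex 1.3 (ii) p.5] -/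
theorem ratPoint_lamEleven_mem_std_two {k : ℕ} (hk : 1 ≤ k) (hS : ∀ p ∈ ({2} : Finset ℕ), p.Prime) :
    ratPoint ((2 : ℚ)⁻¹ + 2 / 11 ^ k) ∈ (CBData.std {2} hS).toSet := by
  refine ⟨fun σ => ?_, fun p hp _ σ => ?_⟩
  · have h1 : σ (ratPoint ((2 : ℚ)⁻¹ + 2 / 11 ^ k)).x = (((2 : ℚ)⁻¹ + 2 / 11 ^ k : ℚ) : ℂ) :=
      eq_ratCast (σ : ℚ →+* ℂ) _
    change σ (ratPoint ((2 : ℚ)⁻¹ + 2 / 11 ^ k)).x ∈ CBData.stdArc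
    rw [h1, CBData.stdArc, mem_closedBall, dist_eq_norm]
    push_cast
    rw [show (2 : ℂ)⁻¹ + 2 / 11 ^ k - 2⁻¹ = 2 / 11 ^ k by ring, norm_div, norm_pow]
    simp only [RCLike.norm_ofNat]
    have h11 : (11 : ℝ) ≤ 11 ^ k := by
      have : ((11 ^ 1 : ℕ) : ℝ) ≤ ((11 ^ k : ℕ) : ℝ) := by exact_mod_cast Nat.pow_le_pow_right (by norm_num) hk
      push_cast at this; linarith
    rw [div_le_iff₀ (by positivity)]
    linarith
  · have hp2 : p = 2 := by change p ∈ ({2} : Finset ℕ) at hp; simpa using hp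
    subst hp2
    have h1 : σ (ratPoint ((2 : ℚ)⁻¹ + 2 / 11 ^ k)).x = (((2 : ℚ)⁻¹ + 2 / 11 ^ k : ℚ) : PadicAlgCl 2) :=
      eq_ratCast (σ : ℚ →+* PadicAlgCl 2) _
    change σ (ratPoint ((2 : ℚ)⁻¹ + 2 / 11 ^ k)).x ∈ CBData.stdNon 2
    rw [h1, CBData.stdNon, mem_closedBall, dist_eq_norm]
    push_cast
    rw [show (2 : PadicAlgCl 2)⁻¹ + 2 / 11 ^ k - 2⁻¹ = 2 / 11 ^ k by ring, norm_div, norm_pow]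
    have h11 : ‖(11 : PadicAlgCl 2)‖ = 1 := by
      have e : (11 : PadicAlgCl 2) = (((11 : ℕ) : ℚ_[2]) : PadicAlgCl 2) := by
        rw [map_natCast]; norm_num
      rw [e, PadicAlgCl.norm_extends, Padic.norm_natCast_eq_one_iff]
      norm_num
    simp only [h11, one_pow, div_one, le_refl]

/-- Numerator bound: `2^6·(3·11^{2k}+16)^3 ≤ 2^{12}·11^{6k}` (`k ≥ 1`, as `16 ≤ 11^{2k}`). [folklore] -/
private theorem numer_le {k : ℕ} (hk : 1 ≤ k) : 64 * (3 * 11 ^ (2 * k) + 16) ^ 3 ≤ 4096 * 11 ^ (6 * k) := by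
  have h121 : 121 ≤ 11 ^ (2 * k) := by
    calc (121 : ℕ) = 11 ^ 2 := by norm_num
      _ ≤ 11 ^ (2 * k) := Nat.pow_le_pow_right (by norm_num) (by omega)
  have h1 : 3 * 11 ^ (2 * k) + 16 ≤ 4 * 11 ^ (2 * k) := by omega
  have h2 : (3 * 11 ^ (2 * k) + 16) ^ 3 ≤ (4 * 11 ^ (2 * k)) ^ 3 := Nat.pow_le_pow_left h1 3
  have h3 : (4 * 11 ^ (2 * k)) ^ 3 = 64 * 11 ^ (6 * k) := by
    rw [mul_pow, ← pow_mul, show 2 * k * 3 = 6 * k by ring]; norm_num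
  calc 64 * (3 * 11 ^ (2 * k) + 16) ^ 3 ≤ 64 * (4 * 11 ^ (2 * k)) ^ 3 := Nat.mul_le_mul_left 64 h2
    _ = 4096 * 11 ^ (6 * k) := by rw [h3]; ring

/-- Denominator bound: `(11^k+4)^2·(11^k−4)^2·11^{2k} ≤ 11^{6k}` (`k ≥ 1`). [folklore] -/
private theorem denom_le {k : ℕ} (hk : 1 ≤ k) : (11 ^ k + 4) ^ 2 * (11 ^ k - 4) ^ 2 * 11 ^ (2 * k) ≤ 11 ^ (6 * k) := by
  have hle : 11 ≤ 11 ^ k := by simpa using Nat.pow_le_pow_right (by norm_num : 1 ≤ 11) hk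
  have h1 : (11 ^ k + 4) * (11 ^ k - 4) ≤ 11 ^ k * 11 ^ k := by
    zify [(by omega : 4 ≤ 11 ^ k)]
    nlinarith
  have h2 : (11 ^ k + 4) ^ 2 * (11 ^ k - 4) ^ 2 ≤ (11 ^ k * 11 ^ k) ^ 2 := by
    rw [← mul_pow]; exact Nat.pow_le_pow_left h1 2
  calc (11 ^ k + 4) ^ 2 * (11 ^ k - 4) ^ 2 * 11 ^ (2 * k) ≤ (11 ^ k * 11 ^ k) ^ 2 * 11 ^ (2 * k) :=
      Nat.mul_le_mul_right _ h2
    _ = 11 ^ (6 * k) := by rw [← pow_add, ← pow_mul, ← pow_add]; ring_nf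

/-- **`log(q^∀(μ_k)) ≤ 6k·log 11 + 12·log 2`** (`k ≥ 1`): `log(q^∀) ≤ ht_∞ = h(j(μ_k))` (`logQForall_le_htInfty`, degree `1`) and the naive height of the
displayed fraction is at most `log(2^{12}·11^{6k})` (adapted from abc-iut-w5-d044's `Cor22.logQForall_ratPoint_lamSeven_le`). [claim: Mochizuki2012, status: disputed] -/
theorem logQForall_ratPoint_lamEleven_le {k : ℕ} (hk : 1 ≤ k) :
    logQForall (ratPoint ((2 : ℚ)⁻¹ + 2 / 11 ^ k)) ≤ 6 * k * Real.log 11 + 12 * Real.log 2 := by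
  refine (logQForall_le_htInfty _).trans ?_
  unfold htInfty
  rw [degree_ratPoint, Nat.cast_one, inv_one, one_mul]
  change Height.logHeight₁ (jInv ((2 : ℚ)⁻¹ + 2 / 11 ^ k)) ≤ _
  rw [Rat.logHeight₁_eq_log_max]
  set A : ℕ := 64 * (3 * 11 ^ (2 * k) + 16) ^ 3 with hAdef
  set D : ℕ := (11 ^ k + 4) ^ 2 * (11 ^ k - 4) ^ 2 * 11 ^ (2 * k) with hDdef
  have hle : 11 ≤ 11 ^ k := by simpa using Nat.pow_le_pow_right (by norm_num : 1 ≤ 11) hk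
  have hA0 : A ≠ 0 := by positivity
  have hD0 : D ≠ 0 := mul_ne_zero (mul_ne_zero (pow_ne_zero _ (by omega)) (pow_ne_zero _ (by omega)))
    (pow_ne_zero _ (by norm_num))
  have hj : jInv ((2 : ℚ)⁻¹ + 2 / 11 ^ k) = Rat.divInt (A : ℤ) (D : ℤ) := by
    rw [Rat.divInt_eq_div, Int.cast_natCast, Int.cast_natCast, hAdef, hDdef, jInv_lamEleven_eq hk,
      Nat.cast_mul (((11 ^ k + 4) ^ 2 * (11 ^ k - 4) ^ 2 : ℕ)) (11 ^ (2 * k)), Nat.cast_pow 11 (2 * k)]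
    norm_num
  have hnum : (jInv ((2 : ℚ)⁻¹ + 2 / 11 ^ k)).num.natAbs ≤ A := by
    rw [hj]
    have h := Rat.num_dvd (A : ℤ) (b := (D : ℤ)) (by exact_mod_cast hD0)
    have h' : (Rat.divInt (A : ℤ) (D : ℤ)).num.natAbs ∣ A := by
      have := Int.natAbs_dvd_natAbs.2 h
      simpa using this
    exact Nat.le_of_dvd (Nat.pos_of_ne_zero hA0) h'
  have hden : (jInv ((2 : ℚ)⁻¹ + 2 / 11 ^ k)).den ≤ D := by
    rw [hj]
    have h := Rat.den_dvd (A : ℤ) (D : ℤ)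
    have h' : (Rat.divInt (A : ℤ) (D : ℤ)).den ∣ D := by exact_mod_cast h
    exact Nat.le_of_dvd (Nat.pos_of_ne_zero hD0) h'
  have hmax : max (jInv ((2 : ℚ)⁻¹ + 2 / 11 ^ k)).num.natAbs (jInv ((2 : ℚ)⁻¹ + 2 / 11 ^ k)).den ≤ 4096 * 11 ^ (6 * k) :=
    max_le (hnum.trans (numer_le hk)) (hden.trans ((denom_le hk).trans (Nat.le_mul_of_pos_left _ (by norm_num))))
  have hpos : (0 : ℝ) < ((max (jInv ((2 : ℚ)⁻¹ + 2 / 11 ^ k)).num.natAbs (jInv ((2 : ℚ)⁻¹ + 2 / 11 ^ k)).den : ℕ) : ℝ) := by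
    have : 0 < (jInv ((2 : ℚ)⁻¹ + 2 / 11 ^ k)).den := Rat.den_pos _
    exact_mod_cast lt_max_of_lt_right this
  calc Real.log ((max (jInv ((2 : ℚ)⁻¹ + 2 / 11 ^ k)).num.natAbs (jInv ((2 : ℚ)⁻¹ + 2 / 11 ^ k)).den : ℕ) : ℝ)
      ≤ Real.log ((4096 * 11 ^ (6 * k) : ℕ) : ℝ) := Real.log_le_log hpos (by exact_mod_cast hmax)
    _ = 6 * k * Real.log 11 + 12 * Real.log 2 := by
      rw [show ((4096 * 11 ^ (6 * k) : ℕ) : ℝ) = (2 : ℝ) ^ 12 * 11 ^ (6 * k) by push_cast; ring,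
        Real.log_mul (by positivity) (by positivity), Real.log_pow, Real.log_pow]
      push_cast
      ring

/-! ## 2. The genuine `11`-components over `μ_k` (instances of the degree-one lemmas `DegOne.*`, p487789) -/

/-- `[ℚ:ℚ] = 1` for the base of `ratPoint μ_k`. [cite: MochizukiGenEll2010, Ex 1.3 (i) p.5] -/
theorem finrank_eq_one (k : ℕ) : Module.finrank ℚ (ratPoint ((2 : ℚ)⁻¹ + 2 / 11 ^ k)).F = 1 :=
  degree_ratPoint _

/-- `ord_v j(μ_k) = −2k` at every place `v` of `ℚ` of residue characteristic `11` (`k ≥ 1`). [cite: MochizukiGenEll2010, Ex 1.3 (i) p.5] -/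
theorem ord_jInv_eq {k : ℕ} (hk : 1 ≤ k) (v : HeightOneSpectrum (𝓞 (ratPoint ((2 : ℚ)⁻¹ + 2 / 11 ^ k)).F))
    (hv : residueChar (ratPoint ((2 : ℚ)⁻¹ + 2 / 11 ^ k)).F v = 11) :
    ord (ratPoint ((2 : ℚ)⁻¹ + 2 / 11 ^ k)).F v (jInv (ratPoint ((2 : ℚ)⁻¹ + 2 / 11 ^ k)).x) = -((2 * k : ℕ) : ℤ) := by
  have h1 : ((Rat.HeightOneSpectrum.natGenerator (show HeightOneSpectrum (𝓞 ℚ) from v) : ℕ) : 𝓞 ℚ) ∈ v.asIdeal :=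
    (UniformABCConjecture.natCast_mem_asIdeal_iff (show HeightOneSpectrum (𝓞 ℚ) from v) _).mpr dvd_rfl
  have h2 : residueChar (ratPoint ((2 : ℚ)⁻¹ + 2 / 11 ^ k)).F v =
      Rat.HeightOneSpectrum.natGenerator (show HeightOneSpectrum (𝓞 ℚ) from v) :=
    (natCast_mem_asIdeal_iff_residueChar_eq v
      (Rat.HeightOneSpectrum.prime_natGenerator (show HeightOneSpectrum (𝓞 ℚ) from v))).mp h1
  have hgen : Rat.HeightOneSpectrum.natGenerator (show HeightOneSpectrum (𝓞 ℚ) from v) = 11 := h2.symm.trans hv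
  have h := ord_jInv_lamEleven (show HeightOneSpectrum (𝓞 ℚ) from v) hgen hk
  push_cast
  exact h

/-- **`11 ∈ V^dst_ℚ` is forced** over `μ_k`: for every finite `M ⊇ ℚ` and every prime `ℓ ≠ 11`, `Supp(𝔮_M)` away from `{2, ℓ}` has a place of residue
characteristic `11`. [cite: Mochizuki2012, IUTchIV Thm. 1.10 p. 23] -/
theorem exists_mem_V_residueChar_eq_eleven {k : ℕ} (hk : 1 ≤ k) {ℓ : ℕ} (hℓ : ℓ.Prime) (hℓ11 : ℓ ≠ 11) (M : Type) [Field M]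
    [NumberField M] [Algebra (ratPoint ((2 : ℚ)⁻¹ + 2 / 11 ^ k)).F M] :
    ∃ w ∈ (TateDivisorDatum.ofNFPointOver (ratPoint ((2 : ℚ)⁻¹ + 2 / 11 ^ k)) {2, ℓ} M).V, residueChar M w = 11 :=
  haveI : Fact (Nat.Prime 11) := ⟨by norm_num⟩
  DegOne.exists_mem_V_residueChar_eq (m := 2 * k) (by omega) (ord_jInv_eq hk) hℓ (by norm_num) hℓ11.symm M

/-- **`q₁₁ = 2k·log 11` EXACTLY** over `μ_k`, for every finite `M ⊇ ℚ` and every `S = {2, ℓ}`, `ℓ ≠ 11` prime.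
[cite: Mochizuki2012, IUTchIV Def. 1.9 (i) p. 22] -/
theorem qEleven_eq {k : ℕ} (hk : 1 ≤ k) {ℓ : ℕ} (hℓ : ℓ.Prime) (hℓ11 : ℓ ≠ 11) (M : Type) [Field M] [NumberField M]
    [Algebra (ratPoint ((2 : ℚ)⁻¹ + 2 / 11 ^ k)).F M] :
    (Module.finrank ℚ M : ℝ)⁻¹ *
      ∑ w ∈ (TateDivisorDatum.ofNFPointOver (ratPoint ((2 : ℚ)⁻¹ + 2 / 11 ^ k)) {2, ℓ} M).V with residueChar M w = 11,
        (TateDivisorDatum.ofNFPointOver (ratPoint ((2 : ℚ)⁻¹ + 2 / 11 ^ k)) {2, ℓ} M).tateDivisor (Sum.inr w) * logNorm M w =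
      2 * k * Real.log 11 := by
  haveI : Fact (Nat.Prime 11) := ⟨by norm_num⟩
  have h := DegOne.qComp_eq (finrank_eq_one k) (m := 2 * k) (by omega) (ord_jInv_eq hk) hℓ (by norm_num) hℓ11.symm M
  push_cast at h
  exact h

/-- **`d₁₁ ≤ log 11` on the genuine tower over `μ_k`**, for every theta field `F ⊇ ℚ`, every `K ⊇ F` Galois inside `F(E_F[ℓ])`, every prime `ℓ ≠ 11`,
every bookkeeping set `D_K` (`11 ∤ 46080`: tame all the way). [cite: Mochizuki2012, IUTchIV Prop. 1.3 p. 12] -/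
theorem dEleven_le {k : ℕ} {F : Type} [Field F] [NumberField F] [Algebra (ratPoint ((2 : ℚ)⁻¹ + 2 / 11 ^ k)).F F]
    {K : Type} [Field K] [NumberField K] [Algebra F K] [Algebra (ratPoint ((2 : ℚ)⁻¹ + 2 / 11 ^ k)).F K]
    [IsScalarTower (ratPoint ((2 : ℚ)⁻¹ + 2 / 11 ^ k)).F F K] (ψ : K →ₐ[F] AlgebraicClosure F)
    (hU : (ratPoint ((2 : ℚ)⁻¹ + 2 / 11 ^ k)).InU) (hF : IsThetaField (ratPoint ((2 : ℚ)⁻¹ + 2 / 11 ^ k)) F) [IsGalois F K]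
    {ℓ : ℕ} (hℓ : ℓ.Prime) (hℓ11 : ℓ ≠ 11)
    (hK : letI := thetaCurve_isElliptic hU F
      ((thetaCurve (ratPoint ((2 : ℚ)⁻¹ + 2 / 11 ^ k)) F).galoisRepTorsion (ℓ : ℤ)).ker ≤ ψ.fieldRange.fixingSubgroup)
    (DK : Finset (HeightOneSpectrum (𝓞 K))) :
    (Module.finrank ℚ K : ℝ)⁻¹ * ∑ u ∈ DK with residueChar K u = 11, differentDivisor K (Sum.inr u) * logNorm K u ≤ Real.log 11 :=
  haveI : Fact (Nat.Prime 11) := ⟨by norm_num⟩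
  DegOne.dComp_le_log (finrank_eq_one k) (by norm_num) ψ hU hF hℓ hℓ11.symm hK DK

end LambdaElevenResidual

end Summit.ABC.IUTFork.Joshi.ATS4

end
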